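import Literature.Geometry.Riemannian.CurvatureOperator
import Literature.Geometry.Riemannian.ConstantCurvature
import Literature.Geometry.Riemannian.RicciFlowScalarCurvatureProofs
import HarnessLib

/-!
# Metrics of constant positive sectional curvature have positive curvature operator
(topic `Geometry/Riemannian`)

A proved complement to `ConstantCurvature.lean` and `CurvatureOperator.lean`, in the setting of
**Hamilton 1986, Thm. 1.1** (`Literature.Geometry.Riemannian.hamilton_positiveCurvatureOperator_classification_four`,
`HamiltonPCOClassification.lean`; reduction in `HamiltonPCOClassificationProofs.lean`): the limit
metrics of Hamilton's flow — metrics of constant sectional curvature `c > 0` (p. 154: "converges as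
`t → ∞` to a metric of constant Riemannian curvature") — lie themselves in the hypothesis class of
the theorem, i.e. have positive curvature operator in the sense of Hamilton, p. 153 ("`Rm(φ, φ) > 0`
for all two-forms `φ ≠ 0`", `PseudoRiemannianMetric.HasPositiveCurvatureOperator`). For
`Rm(X,Y,Z,W) = c (g(Y,Z) g(X,W) - g(X,Z) g(Y,W))` (Lee, *Riemannian Manifolds*, Prop. 8.36) the
curvature operator acts on a 2-vector `φ = Σₐ Xₐ ∧ Yₐ` by
`Rm(φ, φ) = c Σ_{a,b} (g(X_a,X_b) g(Y_a,Y_b) - g(X_a,Y_b) g(Y_a,X_b)) = c |φ|²`, and the point is the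
positivity of the Gram-type expression `|φ|²` for `φ ≠ 0`, which we prove through an orthonormal
basis `e` of `(T_x M, g_x)` (`exists_basis_isOrthonormalFrame`, `RicciFlowScalarCurvatureProofs.lean`):

* `PseudoRiemannianMetric.val_eq_sum_of_isOrthonormalFrame` — Parseval,
  `g(u, v) = Σᵢ g(u, eᵢ) g(v, eᵢ)` (O'Neill 1983, Ch. 2, Lemma 25);
* `PseudoRiemannianMetric.bivectorForm_eq_sum_repr` — `φ♭(v, w) = Σᵢⱼ vⁱ wʲ φ♭(eᵢ, eⱼ)`;
* `PseudoRiemannianMetric.sum_sq_bivectorForm_eq` — the Gram identity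
  `Σᵢⱼ φ♭(eᵢ, eⱼ)² = 2 Σ_{a,b} (g(X_a,X_b) g(Y_a,Y_b) - g(X_a,Y_b) g(Y_a,X_b))`;
* `curvatureOperatorForm_pos_of_curvatureForm_eq` — hence `Rm(φ, φ) = (c/2) Σᵢⱼ φ♭(eᵢ,eⱼ)² > 0`
  when `φ♭ ≠ 0`;
* `HasConstantSectionalCurvatureWith.hasPositiveCurvatureOperatorWith`,
  `HasConstantSectionalCurvature.hasPositiveCurvatureOperator` (**main results**): a Riemannian
  metric of constant sectional curvature `c > 0` has positive curvature operator (Hamilton 1986,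
  p. 154: `S⁴` and `RP⁴` with their constant-curvature metrics are the two models of Thm. 1.1).

Everything here is proved; no facts are vended.

## References

* R. S. Hamilton, *Four-manifolds with positive curvature operator*, J. Differential Geom. 24
  (1986) 153–179, §1, pp. 153–154. [Hamilton1986]
* J. M. Lee, *Introduction to Riemannian Manifolds*, 2nd ed. (2018), Prop. 8.36; Ch. 8
  (the curvature operator on 2-vectors). [Lee2018]
* B. O'Neill, *Semi-Riemannian geometry*, Academic Press 1983, Ch. 2, Lemmas 24–25 (p. 50:
  orthonormal bases and orthonormal expansion). [ONeill1983]
-/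

noncomputable section

open Finset Module
open scoped BigOperators Manifold ContDiff

namespace Literature.Geometry.Riemannian

section PCO
open Literature.Geometry.Lorentzian (PseudoRiemannianMetric)
open Literature.Geometry.Lorentzian.PseudoRiemannianMetric

variable {E : Type*} [NormedAddCommGroup E] [NormedSpace ℝ E] {H : Type*} [TopologicalSpace H]
  {I : ModelWithCorners ℝ E H} {M : Type*} [TopologicalSpace M] [ChartedSpace H M]
  [IsManifold I ∞ M] {n : ℕ∞ω}
  {g : PseudoRiemannianMetric I n E (TangentSpace I : M → Type _)} {x : M}

/-- Reordering a fourfold finite sum. [folklore] -/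
theorem sum_sum_sum_sum_comm {ι κ : Type*} [Fintype ι] [Fintype κ] (f : ι → ι → κ → κ → ℝ) :
    ∑ i, ∑ j, ∑ a, ∑ c, f i j a c = ∑ a, ∑ c, ∑ i, ∑ j, f i j a c := by
  calc ∑ i, ∑ j, ∑ a, ∑ c, f i j a c = ∑ i, ∑ a, ∑ j, ∑ c, f i j a c :=
        Finset.sum_congr rfl fun i _ ↦ Finset.sum_comm
    _ = ∑ a, ∑ i, ∑ j, ∑ c, f i j a c := Finset.sum_comm
    _ = ∑ a, ∑ i, ∑ c, ∑ j, f i j a c :=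
        Finset.sum_congr rfl fun a _ ↦ Finset.sum_congr rfl fun i _ ↦ Finset.sum_comm
    _ = ∑ a, ∑ c, ∑ i, ∑ j, f i j a c := Finset.sum_congr rfl fun a _ ↦ Finset.sum_comm

/-- Reordering a threefold finite sum. [folklore] -/
theorem sum_sum_sum_comm {ι κ : Type*} [Fintype ι] [Fintype κ] (f : κ → ι → ι → ℝ) :
    ∑ a, ∑ i, ∑ j, f a i j = ∑ i, ∑ j, ∑ a, f a i j := by
  calc ∑ a, ∑ i, ∑ j, f a i j = ∑ i, ∑ a, ∑ j, f a i j := Finset.sum_comm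
    _ = ∑ i, ∑ j, ∑ a, f a i j := Finset.sum_congr rfl fun i _ ↦ Finset.sum_comm

/-- **Orthonormal expansion of the metric** (Parseval): `g(u, v) = Σᵢ g(u, eᵢ) g(v, eᵢ)` for a
`g_x`-orthonormal basis `e`. [folklore] -/
theorem _root_.Literature.Geometry.Lorentzian.PseudoRiemannianMetric.val_eq_sum_of_isOrthonormalFrame
    {ι : Type*} [Fintype ι] (b : Basis ι ℝ (TangentSpace I x)) (hb : g.IsOrthonormalFrame x b)
    (u v : TangentSpace I x) : g.val x u v = ∑ i, g.val x u (b i) * g.val x v (b i) := by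
  conv_lhs => rw [← b.sum_repr v]
  rw [map_sum]
  refine Finset.sum_congr rfl fun i _ ↦ ?_
  rw [map_smul, g.basis_repr_of_isOrthonormalFrame b hb v i, smul_eq_mul, mul_comm]

/-- **Orthonormal expansion of the alternating form of a 2-vector**:
`φ♭(v, w) = Σᵢⱼ vⁱ wʲ φ♭(eᵢ, eⱼ)` (bilinearity of `bivectorForm` in `(v, w)`). [folklore] -/
theorem _root_.Literature.Geometry.Lorentzian.PseudoRiemannianMetric.bivectorForm_eq_sum_repr
    {ι : Type*} [Fintype ι] (b : Basis ι ℝ (TangentSpace I x)) {m : ℕ}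
    (X Y : Fin m → TangentSpace I x) (v w : TangentSpace I x) :
    g.bivectorForm x X Y v w =
      ∑ i, ∑ j, b.repr v i * b.repr w j * g.bivectorForm x X Y (b i) (b j) := by
  have hv : ∀ u : TangentSpace I x, g.val x u v = ∑ i, b.repr v i * g.val x u (b i) := by
    intro u
    conv_lhs => rw [← b.sum_repr v]
    rw [map_sum]
    exact Finset.sum_congr rfl fun i _ ↦ by rw [map_smul, smul_eq_mul]
  have hw : ∀ u : TangentSpace I x, g.val x u w = ∑ j, b.repr w j * g.val x u (b j) := by
    intro u
    conv_lhs => rw [← b.sum_repr w]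
    rw [map_sum]
    exact Finset.sum_congr rfl fun j _ ↦ by rw [map_smul, smul_eq_mul]
  simp only [bivectorForm]
  calc ∑ a, (g.val x (X a) v * g.val x (Y a) w - g.val x (Y a) v * g.val x (X a) w)
      = ∑ a, ∑ i, ∑ j, b.repr v i * b.repr w j *
          (g.val x (X a) (b i) * g.val x (Y a) (b j) - g.val x (Y a) (b i) * g.val x (X a) (b j)) := by
        refine Finset.sum_congr rfl fun a _ ↦ ?_
        rw [hv (X a), hw (Y a), hv (Y a), hw (X a), Finset.sum_mul_sum, Finset.sum_mul_sum,
          ← Finset.sum_sub_distrib]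
        refine Finset.sum_congr rfl fun i _ ↦ ?_
        rw [← Finset.sum_sub_distrib]
        exact Finset.sum_congr rfl fun j _ ↦ by ring
    _ = ∑ i, ∑ j, ∑ a, b.repr v i * b.repr w j *
          (g.val x (X a) (b i) * g.val x (Y a) (b j) - g.val x (Y a) (b i) * g.val x (X a) (b j)) :=
        sum_sum_sum_comm _
    _ = ∑ i, ∑ j, b.repr v i * b.repr w j *
          ∑ a, (g.val x (X a) (b i) * g.val x (Y a) (b j) - g.val x (Y a) (b i) * g.val x (X a) (b j)) := by
        refine Finset.sum_congr rfl fun i _ ↦ Finset.sum_congr rfl fun j _ ↦ ?_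
        rw [Finset.mul_sum]

/-- **The Gram identity for 2-vectors**: in a `g_x`-orthonormal basis `e`,
`Σᵢⱼ φ♭(eᵢ, eⱼ)² = 2 Σ_{a,c} (g(X_a,X_c) g(Y_a,Y_c) - g(X_a,Y_c) g(Y_a,X_c))` for
`φ = Σₐ Xₐ ∧ Yₐ` — i.e. `|φ|² = ½ Σᵢⱼ φᵢⱼ²` equals the Gram-type expression through which the
curvature operator of a constant-curvature metric acts. [folklore] -/
theorem _root_.Literature.Geometry.Lorentzian.PseudoRiemannianMetric.sum_sq_bivectorForm_eq
    {ι : Type*} [Fintype ι] (b : Basis ι ℝ (TangentSpace I x)) (hb : g.IsOrthonormalFrame x b)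
    {m : ℕ} (X Y : Fin m → TangentSpace I x) :
    ∑ i, ∑ j, (g.bivectorForm x X Y (b i) (b j)) ^ 2 =
      2 * ∑ a, ∑ c, (g.val x (X a) (X c) * g.val x (Y a) (Y c) -
        g.val x (X a) (Y c) * g.val x (Y a) (X c)) := by
  set xx : Fin m → ι → ℝ := fun a i ↦ g.val x (X a) (b i) with hxx
  set yy : Fin m → ι → ℝ := fun a i ↦ g.val x (Y a) (b i) with hyy
  have hφ : ∀ i j, g.bivectorForm x X Y (b i) (b j) = ∑ a, (xx a i * yy a j - yy a i * xx a j) := by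
    intro i j
    simp [bivectorForm, hxx, hyy]
  have P : ∀ u v : TangentSpace I x, g.val x u v = ∑ i, g.val x u (b i) * g.val x v (b i) :=
    g.val_eq_sum_of_isOrthonormalFrame b hb
  -- the summand for fixed `a, c`, in coordinates
  set U : Fin m → Fin m → ι → ι → ℝ :=
    fun a c i j ↦ xx a i * xx c i * (yy a j * yy c j) - xx a i * yy c i * (yy a j * xx c j) with hU
  have hR : ∀ a c, g.val x (X a) (X c) * g.val x (Y a) (Y c) -
      g.val x (X a) (Y c) * g.val x (Y a) (X c) = ∑ i, ∑ j, U a c i j := by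
    intro a c
    rw [P (X a) (X c), P (Y a) (Y c), P (X a) (Y c), P (Y a) (X c), Finset.sum_mul_sum,
      Finset.sum_mul_sum, ← Finset.sum_sub_distrib]
    refine Finset.sum_congr rfl fun i _ ↦ ?_
    rw [← Finset.sum_sub_distrib]
  calc ∑ i, ∑ j, (g.bivectorForm x X Y (b i) (b j)) ^ 2
      = ∑ i, ∑ j, ∑ a, ∑ c,
          (xx a i * yy a j - yy a i * xx a j) * (xx c i * yy c j - yy c i * xx c j) := by
        refine Finset.sum_congr rfl fun i _ ↦ Finset.sum_congr rfl fun j _ ↦ ?_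
        rw [hφ, sq, Finset.sum_mul_sum]
    _ = ∑ a, ∑ c, ∑ i, ∑ j,
          (xx a i * yy a j - yy a i * xx a j) * (xx c i * yy c j - yy c i * xx c j) :=
        sum_sum_sum_sum_comm _
    _ = ∑ a, ∑ c, ∑ i, ∑ j, (U a c i j + U a c j i) := by
        refine Finset.sum_congr rfl fun a _ ↦ Finset.sum_congr rfl fun c _ ↦
          Finset.sum_congr rfl fun i _ ↦ Finset.sum_congr rfl fun j _ ↦ ?_
        simp only [hU]
        ring
    _ = ∑ a, ∑ c, 2 * ∑ i, ∑ j, U a c i j := by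
        refine Finset.sum_congr rfl fun a _ ↦ Finset.sum_congr rfl fun c _ ↦ ?_
        have hswap : ∑ i, ∑ j, U a c j i = ∑ i, ∑ j, U a c i j := Finset.sum_comm
        simp only [Finset.sum_add_distrib]
        rw [hswap, two_mul]
    _ = 2 * ∑ a, ∑ c, (g.val x (X a) (X c) * g.val x (Y a) (Y c) -
          g.val x (X a) (Y c) * g.val x (Y a) (X c)) := by
        rw [Finset.mul_sum]
        refine Finset.sum_congr rfl fun a _ ↦ ?_
        rw [Finset.mul_sum]
        exact Finset.sum_congr rfl fun c _ ↦ by rw [hR]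

variable (cov : CovariantDerivative I E (TangentSpace I : M → Type _))

/-- **Constant sectional curvature `c > 0` implies positive curvature operator** (pointwise
version): if at `x` the curvature of `(g, cov)` is `Rm(X,Y,Z,W) = c (g(Y,Z) g(X,W) - g(X,Z) g(Y,W))`
with `c > 0` and `g_x` is positive definite, then `Rm(φ, φ) > 0` for every 2-vector `φ ≠ 0` at `x`:
`Rm(φ, φ) = c |φ|²` with `|φ|² = ½ Σᵢⱼ φ♭(eᵢ, eⱼ)²` in an orthonormal basis
(`sum_sq_bivectorForm_eq`), and `φ♭ ≠ 0` forces some `φ♭(eᵢ, eⱼ) ≠ 0`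
(`bivectorForm_eq_sum_repr`). [folklore] -/
theorem curvatureOperatorForm_pos_of_curvatureForm_eq [FiniteDimensional ℝ E] {c : ℝ} (hc : 0 < c)
    (hpos : ∀ v : TangentSpace I x, v ≠ 0 → 0 < g.val x v v)
    (h : ∀ X Y Z W : TangentSpace I x,
      g.curvatureForm cov x X Y Z W = c * (g.val x Y Z * g.val x X W - g.val x X Z * g.val x Y W))
    {m : ℕ} (X Y : Fin m → TangentSpace I x)
    (hφ : ∃ v w : TangentSpace I x, g.bivectorForm x X Y v w ≠ 0) :
    0 < g.curvatureOperatorForm cov x X Y := by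
  obtain ⟨b, hb⟩ := g.exists_basis_isOrthonormalFrame hpos rfl
  -- `Rm(φ, φ) = c · Q`
  have hQ : g.curvatureOperatorForm cov x X Y = c * ∑ a, ∑ a', (g.val x (X a) (X a') *
      g.val x (Y a) (Y a') - g.val x (X a) (Y a') * g.val x (Y a) (X a')) := by
    simp only [curvatureOperatorForm, h, Finset.mul_sum]
    exact Finset.sum_congr rfl fun a _ ↦ Finset.sum_congr rfl fun a' _ ↦ by ring
  -- some `φ♭(eᵢ, eⱼ) ≠ 0`
  obtain ⟨v, w, hvw⟩ := hφ
  have hex : ∃ i j, g.bivectorForm x X Y (b i) (b j) ≠ 0 := by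
    by_contra hall
    push Not at hall
    apply hvw
    rw [g.bivectorForm_eq_sum_repr b X Y v w]
    exact Finset.sum_eq_zero fun i _ ↦ Finset.sum_eq_zero fun j _ ↦ by rw [hall i j, mul_zero]
  obtain ⟨i, j, hij⟩ := hex
  -- `2 Q = Σ φ♭(eᵢ,eⱼ)² > 0`
  have hsum : 0 < ∑ i, ∑ j, (g.bivectorForm x X Y (b i) (b j)) ^ 2 := by
    have hle : (g.bivectorForm x X Y (b i) (b j)) ^ 2 ≤
        ∑ i, ∑ j, (g.bivectorForm x X Y (b i) (b j)) ^ 2 := by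
      calc (g.bivectorForm x X Y (b i) (b j)) ^ 2
          ≤ ∑ j, (g.bivectorForm x X Y (b i) (b j)) ^ 2 :=
            Finset.single_le_sum (f := fun j ↦ (g.bivectorForm x X Y (b i) (b j)) ^ 2)
              (fun j _ ↦ sq_nonneg _) (Finset.mem_univ j)
        _ ≤ ∑ i, ∑ j, (g.bivectorForm x X Y (b i) (b j)) ^ 2 :=
            Finset.single_le_sum (f := fun i ↦ ∑ j, (g.bivectorForm x X Y (b i) (b j)) ^ 2)
              (fun i _ ↦ Finset.sum_nonneg fun j _ ↦ sq_nonneg _) (Finset.mem_univ i)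
    exact lt_of_lt_of_le (sq_pos_iff.mpr hij) hle
  rw [g.sum_sq_bivectorForm_eq b hb X Y] at hsum
  rw [hQ]
  exact mul_pos hc (by linarith)


variable {cov}

/-- **A Riemannian metric of constant sectional curvature `c > 0` has positive curvature operator**
(for the pair `(g, cov)`): `Rm(φ, φ) = c |φ|² > 0` for every 2-vector `φ ≠ 0`
(`curvatureOperatorForm_pos_of_curvatureForm_eq` at every point). Hamilton 1986, p. 153 (the
definition) and p. 154 (the constant-curvature limits / the models `S⁴`, `RP⁴`); Lee, Prop. 8.36.
[cite: Hamilton1986, §1, pp. 153–154] [cite: Lee2018, Prop. 8.36] -/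
theorem _root_.Literature.Geometry.Lorentzian.PseudoRiemannianMetric.HasConstantSectionalCurvatureWith.hasPositiveCurvatureOperatorWith
    [FiniteDimensional ℝ E] {c : ℝ} (h : g.HasConstantSectionalCurvatureWith cov c)
    (hg : g.IsRiemannian) (hc : 0 < c) : g.HasPositiveCurvatureOperatorWith cov :=
  fun x _ X Y hφ ↦
    curvatureOperatorForm_pos_of_curvatureForm_eq cov hc (fun v hv ↦ hg x v hv) (h x) X Y hφ

/-- **A Riemannian metric of constant sectional curvature `c > 0` has positive curvature operator**
(Hamilton's hypothesis-free form over the Levi-Civita connections of `g`,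
`HasPositiveCurvatureOperator`): the metrics "of constant Riemannian curvature" to which Hamilton's
flow converges (1986, p. 154), in particular the round `S⁴` and `RP⁴`, satisfy the hypothesis of
his Thm. 1.1. [cite: Hamilton1986, §1, pp. 153–154] [cite: Lee2018, Prop. 8.36] -/
theorem _root_.Literature.Geometry.Lorentzian.PseudoRiemannianMetric.HasConstantSectionalCurvature.hasPositiveCurvatureOperator
    [FiniteDimensional ℝ E] [CompleteSpace E] {c : ℝ} (h : g.HasConstantSectionalCurvature c)
    (hg : g.IsRiemannian) (hc : 0 < c) : g.HasPositiveCurvatureOperator :=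
  fun _ hcov ↦ (h.with hcov).hasPositiveCurvatureOperatorWith hg hc

end PCO

end Literature.Geometry.Riemannian

end
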